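import Summits.QuantumAdvantage.QuantumAdvantage.Theorems.CharDialSegmentMovesB
import HarnessLib

/-!
# CharDial / JLinPeel — segment moves C: the dense single-form family is on the HIGH side of the variation dial (decomp-qadv lens-6 g17, §37h)

Prop-free tree twin of annex §37h of `OrbitDial37.lean` (pub/decomp-qadv/decomp-qadv-lens-6/g17/).  Sequel of
`CharDialSegmentMovesB.lean` (uses `form_segCompl`, `neAdj_iff`, `swapInf`, `swapMass`, `lowPositions`).  Content: the family `denseY p n`
(cut `g` ↦ `[Σ_i [u_i]·i = g (mod p)]`), its junta ⊕ one-form presentation `denseY_jlin`, the swap law `denseForm_swap` / `denseY_flip`,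
the residue count of cuts `card_cuts_residue_ge`, the mass bound `swapMass_denseY_ge`, and `not_low_denseY` / `high_inhabited`:
for every prime `p` and all `n ≥ n₁(p)` at most one position has swap mass `≤ 4(log₂ n + 1)·2ⁿ`.  0 sorry.

WHAT THIS IS NOT: no statement about the win probability of the dense family (that is the HIGH piece of the dial, open).
-/

set_option autoImplicit false

namespace Summit.QuantumAdvantage.AdviceFreeQNC0.JLinPeel.SegMove

open Finset
open Summit.QuantumAdvantage.AdviceFreeQNC0

variable {n : ℕ}

/-! ### the dense single-form family: the HIGH side of the variation dial is inhabited (every prime `p`, all large `n`)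

Every cut `g` carries the SAME dense `𝔽_p`-form `S(u) = Σ_i [u_i]·i` through the shifted indicator `[S(u) = g (mod p)]` (junta part empty).
An adjacent swap of two different bits moves `S` by `±1 ≠ 0`, so every input with `u_i ≠ u_{i+1}` and `S(u) ≡ g` is swap-sensitive for cut
`g`; summing over the cuts the residue condition disappears (`≥ (n+1)/p − 1` cuts per residue class) and the swap mass of EVERY position
`i ≤ n − 2` satisfies `2·swapMass ≥ ((n+1)/p − 1)·2ⁿ > 2·4(log₂ n + 1)·2ⁿ` for `n ≥ n₁(p)`: at most one position is low. -/

/-- the dense form `S(u) = Σ_i [u_i]·(i mod p)`. -/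
def denseForm (p : ℕ) (u : Fin n → Bool) : ZMod p := ∑ i : Fin n, if u i then ((i : ℕ) : ZMod p) else 0

/-- the separating family: cut `g` outputs `[S(u) = g (mod p)]`. -/
def denseY (p n : ℕ) : Fin (n + 1) → (Fin n → Bool) → Bool :=
  fun g u => decide (denseForm p u = ((g : ℕ) : ZMod p))

/-- `denseY` satisfies the CharDial hypothesis (empty junta, coefficients `a_i = i`, `h(·, s) = [s = g]`), stated in the tree's words. -/
theorem denseY_jlin (p n : ℕ) : ∀ g : Fin (n + 1), ∃ J : Finset (Fin n), J.card ≤ Nat.log 2 n ∧ ∃ a : Fin n → ZMod p,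
    ∃ h : (Fin n → Bool) → ZMod p → Bool, (∀ u v : Fin n → Bool, (∀ i ∈ J, u i = v i) → ∀ s, h u s = h v s) ∧
      ∀ u, denseY p n g u = h u (∑ i, if u i then a i else 0) := by
  intro g
  refine ⟨∅, by simp, fun i => ((i : ℕ) : ZMod p), fun _ s => decide (s = ((g : ℕ) : ZMod p)), ?_, ?_⟩
  · intro u v _ s
    rfl
  · intro u
    rfl

/-- an adjacent swap of two different bits moves the dense form by `±1`. -/
theorem denseForm_swap (p : ℕ) (u : Fin n → Bool) (s t : Fin n) (hst : t.val = s.val + 1) (hne : u s ≠ u t) :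
    denseForm p (segCompl u s.val (s.val + 2)) = denseForm p u + (if u s = true then 1 else -1) := by
  have h := form_segCompl (fun i : Fin n => ((i : ℕ) : ZMod p)) u s.val (s.val + 2)
  unfold form at h
  unfold denseForm
  rw [h]
  congr 1
  have hst' : s ≠ t := fun h => by rw [h] at hst; omega
  rw [Finset.sum_eq_add s t hst']
  · have hs : (s.val ≤ s.val ∧ s.val < s.val + 2) := ⟨le_rfl, by omega⟩
    have ht : (s.val ≤ t.val ∧ t.val < s.val + 2) := ⟨by omega, by omega⟩
    simp only [hs, ht, and_self, if_true]
    have htv : ((t : ℕ) : ZMod p) = ((s : ℕ) : ZMod p) + 1 := by rw [hst]; push_cast; ring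
    rcases Bool.eq_false_or_eq_true (u s) with hus | hus
    · have hut : u t = false := by
        rcases Bool.eq_false_or_eq_true (u t) with h' | h'
        · exact absurd (hus.trans h'.symm) hne
        · exact h'
      simp [hus, hut, htv]
    · have hut : u t = true := by
        rcases Bool.eq_false_or_eq_true (u t) with h' | h'
        · exact h'
        · exact absurd (hus.trans h'.symm) hne
      simp [hus, hut, htv]
  · intro c _ hc
    have : ¬ (s.val ≤ c.val ∧ c.val < s.val + 2) := by
      rintro ⟨h1, h2⟩
      rcases hc with ⟨hcs, hct⟩
      have : c.val = s.val ∨ c.val = s.val + 1 := by omega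
      rcases this with h | h
      · exact hcs (Fin.ext h)
      · exact hct (Fin.ext (by omega))
    rw [if_neg this]
  · intro h; exact absurd (mem_univ s) h
  · intro h; exact absurd (mem_univ t) h

/-- hence a swap-sensitive input for cut `g`: `S(u) ≡ g` and `u_s ≠ u_t` force `denseY g` to flip under the swap. -/
theorem denseY_flip (p n : ℕ) [hp : Fact p.Prime] (g : Fin (n + 1)) (u : Fin n → Bool) (s t : Fin n)
    (hst : t.val = s.val + 1) (hne : u s ≠ u t) (hu : denseForm p u = ((g : ℕ) : ZMod p)) :
    denseY p n g (segCompl u s.val (s.val + 2)) ≠ denseY p n g u := by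
  haveI : Fact (1 < p) := ⟨hp.out.one_lt⟩
  unfold denseY
  rw [denseForm_swap p u s t hst hne, hu]
  rcases Bool.eq_false_or_eq_true (u s) with hus | hus
  · simp [hus]
  · simp [hus]

/-- the cuts in a residue class mod `p` number at least `(n+1)/p − 1`. -/
theorem card_cuts_residue_ge (p n : ℕ) [hp : Fact p.Prime] (v : ZMod p) :
    (n + 1) / p - 1 ≤ (univ.filter fun g : Fin (n + 1) => ((g : ℕ) : ZMod p) = v).card := by
  haveI : NeZero p := ⟨hp.out.ne_zero⟩
  have hp0 : 0 < p := hp.out.pos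
  set m := (n + 1) / p - 1 with hm
  have hmp : m * p ≤ n + 1 := le_trans (Nat.mul_le_mul_right p (Nat.sub_le _ _)) (Nat.div_mul_le_self (n + 1) p)
  have hv : v.val < p := ZMod.val_lt v
  have hbound : ∀ k : Fin m, v.val + k.val * p < n + 1 := by
    intro k
    have hk : (k.val + 1) * p ≤ m * p := Nat.mul_le_mul_right p (by have := k.isLt; omega)
    have : v.val + k.val * p < (k.val + 1) * p := by rw [Nat.add_mul, one_mul]; omega
    omega
  let f : Fin m → Fin (n + 1) := fun k => ⟨v.val + k.val * p, hbound k⟩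
  have hcard : (univ : Finset (Fin m)).card = m := by simp
  rw [← hcard]
  refine Finset.card_le_card_of_injOn f ?_ ?_
  · intro k _
    simp only [coe_filter, mem_univ, true_and, Set.mem_setOf_eq, f]
    push_cast
    rw [ZMod.natCast_zmod_val, ZMod.natCast_self, mul_zero, add_zero]
  · intro k _ k' _ hkk
    have h1 : v.val + k.val * p = v.val + k'.val * p := by
      have := congrArg Fin.val hkk
      simpa [f] using this
    exact Fin.ext (Nat.eq_of_mul_eq_mul_right hp0 (by omega))

/-- at least half of all inputs carry different bits at two given distinct positions. -/
theorem two_pow_le_two_mul_card_ne (s t : Fin n) (hst : s ≠ t) :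
    2 ^ n ≤ 2 * (univ.filter fun u : Fin n → Bool => u s ≠ u t).card := by
  set A := univ.filter fun u : Fin n → Bool => u s ≠ u t with hA
  set E := univ.filter fun u : Fin n → Bool => ¬ (u s ≠ u t) with hE
  have hsum : A.card + E.card = 2 ^ n := by
    rw [hA, hE, card_filter_add_card_filter_not, card_univ, Fintype.card_fun, Fintype.card_bool, Fintype.card_fin]
  have hEA : E.card ≤ A.card := by
    refine Finset.card_le_card_of_injOn (fun u => Function.update u s (!u s)) ?_ ?_
    · intro u hu
      have hu' : u s = u t := by
        rw [hE, mem_coe, mem_filter] at hu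
        simpa using hu.2
      rw [hA, mem_coe, mem_filter]
      refine ⟨mem_univ _, ?_⟩
      show Function.update u s (!u s) s ≠ Function.update u s (!u s) t
      rw [Function.update_self, Function.update_of_ne hst.symm, ← hu']
      cases u s <;> simp
    · intro u _ u' _ h
      funext i
      by_cases hi : i = s
      · subst hi
        have := congrFun h i
        simp only [Function.update_self] at this
        simpa using this
      · have := congrFun h i
        simpa [Function.update_of_ne hi] using this
  omega

/-- **swap mass of the dense family**: every position `i ≤ n − 2` has `2·swapMass ≥ ((n+1)/p − 1)·2ⁿ`. -/
theorem swapMass_denseY_ge (p n : ℕ) [hp : Fact p.Prime] (s t : Fin n) (hst : t.val = s.val + 1) :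
    ((n + 1) / p - 1) * 2 ^ n ≤ 2 * swapMass (denseY p n) s.val := by
  have hst' : s ≠ t := fun h => by rw [h] at hst; omega
  set m := (n + 1) / p - 1
  set A := univ.filter fun u : Fin n → Bool => u s ≠ u t
  -- (1) per cut, the residue-`g` inputs with different bits at `s, t` are swap-sensitive
  have hcut : ∀ g : Fin (n + 1),
      (univ.filter fun u : Fin n → Bool => u s ≠ u t ∧ denseForm p u = ((g : ℕ) : ZMod p)).card ≤ swapInf (denseY p n) g s.val := by
    intro g
    refine card_le_card fun u hu => ?_
    rcases mem_filter.1 hu with ⟨-, hne, hform⟩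
    exact mem_filter.2 ⟨mem_univ _, (neAdj_iff u _).2 ⟨s, t, rfl, hst, hne⟩, denseY_flip p n g u s t hst hne hform⟩
  -- (2) sum over the cuts and exchange: each input of `A` is counted once per cut in its residue class
  have hx : m * A.card ≤ ∑ g : Fin (n + 1),
      (univ.filter fun u : Fin n → Bool => u s ≠ u t ∧ denseForm p u = ((g : ℕ) : ZMod p)).card := by
    have hrw : ∀ g : Fin (n + 1),
        (univ.filter fun u : Fin n → Bool => u s ≠ u t ∧ denseForm p u = ((g : ℕ) : ZMod p)).card =
          ∑ u : Fin n → Bool, if u s ≠ u t ∧ denseForm p u = ((g : ℕ) : ZMod p) then 1 else 0 := by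
      intro g; rw [card_filter]
    simp_rw [hrw]
    rw [Finset.sum_comm]
    have hA : m * A.card = ∑ u : Fin n → Bool, if u s ≠ u t then m else 0 := by
      rw [← Finset.sum_filter, sum_const, smul_eq_mul, mul_comm]
    rw [hA]
    refine sum_le_sum fun u _ => ?_
    by_cases hu : u s ≠ u t
    · rw [if_pos hu]
      have : ∑ g : Fin (n + 1), (if u s ≠ u t ∧ denseForm p u = ((g : ℕ) : ZMod p) then 1 else 0) =
          (univ.filter fun g : Fin (n + 1) => ((g : ℕ) : ZMod p) = denseForm p u).card := by
        rw [card_filter]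
        refine sum_congr rfl fun g _ => ?_
        by_cases hg : ((g : ℕ) : ZMod p) = denseForm p u
        · simp [hu, hg]
        · have : ¬ denseForm p u = ((g : ℕ) : ZMod p) := fun h => hg h.symm
          simp [this, hg]
      rw [this]
      exact card_cuts_residue_ge p n (denseForm p u)
    · rw [if_neg hu]
      exact Nat.zero_le _
  -- (3) combine with `2·#A ≥ 2ⁿ`
  have hA2 := two_pow_le_two_mul_card_ne s t hst'
  have hmass : ∑ g : Fin (n + 1),
      (univ.filter fun u : Fin n → Bool => u s ≠ u t ∧ denseForm p u = ((g : ℕ) : ZMod p)).card ≤ swapMass (denseY p n) s.val := by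
    unfold swapMass
    exact sum_le_sum fun g _ => hcut g
  calc m * 2 ^ n ≤ m * (2 * A.card) := Nat.mul_le_mul_left m hA2
    _ = 2 * (m * A.card) := by ring
    _ ≤ 2 * swapMass (denseY p n) s.val := Nat.mul_le_mul_left 2 (le_trans hx hmass)

/-- **the dense family is on the HIGH side** of the variation dial at threshold `4(log₂ n + 1)` once `(n+1)/p − 1 > 8(log₂ n + 1)` (and `n ≥ 3`):
fewer than half of the positions (in fact at most one) have low swap mass. -/
theorem not_low_denseY (p n : ℕ) [hp : Fact p.Prime] (hn : 3 ≤ n) (hm : 2 * (4 * (Nat.log 2 n + 1)) + 1 ≤ (n + 1) / p - 1) :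
    ¬ (n ≤ 2 * (lowPositions n (denseY p n) (4 * (Nat.log 2 n + 1))).card) := by
  intro hlow
  have hsub : lowPositions n (denseY p n) (4 * (Nat.log 2 n + 1)) ⊆ {n - 1} := by
    intro i hi
    rcases mem_filter.1 hi with ⟨hir, hmass⟩
    rw [mem_range] at hir
    rw [mem_singleton]
    by_contra hne
    have hi1 : i + 1 < n := by omega
    have h := swapMass_denseY_ge p n ⟨i, by omega⟩ ⟨i + 1, hi1⟩ rfl
    have h2n : 0 < 2 ^ n := Nat.two_pow_pos n
    have : (2 * (4 * (Nat.log 2 n + 1)) + 1) * 2 ^ n ≤ 2 * ((4 * (Nat.log 2 n + 1)) * 2 ^ n) :=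
      le_trans (Nat.mul_le_mul_right _ hm) (le_trans h (Nat.mul_le_mul_left 2 hmass))
    nlinarith
  have := card_le_card hsub
  rw [card_singleton] at this
  omega

/-- `(k+1)² ≤ 4·2ᵏ`. -/
theorem succ_sq_le_four_mul_two_pow (k : ℕ) : (k + 1) * (k + 1) ≤ 4 * 2 ^ k := by
  induction k with
  | zero => norm_num
  | succ k ih =>
    have hk : k < 2 ^ k := Nat.lt_two_pow_self
    rw [pow_succ]
    nlinarith

/-- `C·(log₂ n + 1) ≤ n` for all large `n`. -/
theorem eventually_mul_log_le (C : ℕ) : ∃ n₁, ∀ n ≥ n₁, C * (Nat.log 2 n + 1) ≤ n := by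
  refine ⟨2 ^ (8 * C), fun n hn => ?_⟩
  have hn0 : n ≠ 0 := by have := Nat.one_le_two_pow (n := 8 * C); omega
  set k := Nat.log 2 n with hk
  have hkn : 2 ^ k ≤ n := Nat.pow_log_le_self 2 hn0
  have h8 : 8 * C ≤ k := Nat.le_log_of_pow_le (by norm_num) hn
  have h1 : 8 * C * (k + 1) ≤ (k + 1) * (k + 1) := Nat.mul_le_mul_right (k + 1) (by omega)
  have h2 := succ_sq_le_four_mul_two_pow k
  have h3 : 8 * (C * (k + 1)) ≤ 4 * 2 ^ k := by rw [← mul_assoc]; exact le_trans h1 h2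
  omega

/-- **SEPARATION.** for every prime `p` there is `n₁` such that for all `n ≥ n₁` the dense family (which satisfies the junta ⊕ one-form
hypothesis, `denseY_jlin`) is on the HIGH side of the variation dial at threshold `4(log₂ n + 1)`. -/
theorem high_inhabited (p : ℕ) [hp : Fact p.Prime] :
    ∃ n₁, ∀ n ≥ n₁, ¬ (n ≤ 2 * (lowPositions n (denseY p n) (4 * (Nat.log 2 n + 1))).card) := by
  obtain ⟨n₁, hn₁⟩ := eventually_mul_log_le (10 * p)
  have hp0 : 0 < p := hp.out.pos
  refine ⟨max n₁ 3, fun n hn => not_low_denseY p n (le_trans (le_max_right _ _) hn) ?_⟩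
  have h := hn₁ n (le_trans (le_max_left _ _) hn)
  have hdiv : 2 * (4 * (Nat.log 2 n + 1)) + 2 ≤ (n + 1) / p := by
    rw [Nat.le_div_iff_mul_le hp0]
    nlinarith
  omega

end Summit.QuantumAdvantage.AdviceFreeQNC0.JLinPeel.SegMove
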